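import Mathlib
import Literature.Probability.Percolation.PercolationProofs
import Literature.Probability.LatticeModels.ProdBernoulliIndependence
import Literature.Probability.Percolation.KozmaNitzanPinning
import Summits.CriticalPhenomena.PercolationContinuityZ3.Theorems.PercNearOneGluingNoHeavyLowerTailFatMinorityOrderedAnchor
import Summits.CriticalPhenomena.PercolationContinuityZ3.Theorems.PercNearOneGluingNoHeavyLowerTailFatMinorityPieceGluing
import Summits.CriticalPhenomena.PercolationContinuityZ3.Theorems.PercNearOneGluingNoHeavyLowerTailFatMinorityMovingAnchorCertificate
import HarnessLib

/-!
# `NoHeavyLowerTail` (stmt-CriticalPhenomena-4575), line fat-minority-linear — the DEFICIENT-ORDER theorem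
# (Kozma–Nitzan's Question 9 at depth 2 for a glued block: only the Λ-deficient relays need a certificate)

Route task `nh-dp-fatminority` (gen 7).  Setting of `orderedAnchor_of_pieces`: observer `o` glued by
weight-`1` pairs to its units `X`, units attached only to relays `A` (and `o`), `a, b ∈ A`, `rk` an
injective rank on `A`; `K = {s(o,x) : x ∈ X}`, `T_c = {s(x,c') : x ∈ X, rk c' < rk c}`.

* `orderedAnchor_deficient` — PEELING BY RELAYS IN ANY ORDER, WITH FREE RELAYS.  Suppose that every relay
  `c ∉ {a, b}` is certified in ONE of two ways:
  (S1) `a ≤ c` in the BACKGROUND `Λ = pinW w (K ∪ X×A) ∅` (all attachments deleted; then the piece of `c`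
       is a sum of Kozma–Nitzan Lemma-5 cells — `movingAnchor_certificate` with the whole block fired), or
  (S2) `a ≤ c` in `Γ'_c = pinW (pinW w T_c ∅) K ∅` (the block UNGLUED, attachments into earlier relays
       deleted; then the piece of `c` follows from the signed Lemma 3(i) — `pieceGluing_obs`).
  Then `μ(o ↔ A, o ↮ b) ≤ μ(o ↔ A, a ↮ b)` (pre-FKG inequality with the FIXED anchor `a`, constant `1`).
  Relays that are at least as reliable as `a` in the background never need a comparison in the deleted
  graphs, whatever their rank: compared with the ordering lemma `OL` (false in general,
  `not_orderingLemma`) the hypothesis is required only for the Λ-DEFICIENT relays, and compared with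
  `orderedAnchor_glued` it is stated in unglued graphs.  With `a = a† := argmin_{G∖o} μ(·↔b)` the first
  relay of any rank is certified by (S2) with `T = ∅`; numerically (gen 7) some rank certifies `a†` in
  every sampled instance that is not already settled by Lemma 5 / `thm5_anchor_preFKG_star`.
* `orderedAnchor_deficient_bad_le` — hence `μ(o ↔ A, o ↮ b) ≤ μ(a ↮ b)`.
No new definitions. [cite: KozmaNitzan2024, §3.2 Lemma 5, Theorems 4–5 (p. 13), Question 9 (p. 36)]
-/

namespace Summit.CriticalPhenomena.PercolationContinuityZ3.Theorems

open MeasureTheory Set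
open Literature.Probability.LatticeModels (prodBernoulli)
open Literature.Probability.Percolation (BondConfig openConn openGraph openGraph_adj)
open scoped BigOperators

noncomputable section
open Classical
open Literature.Probability.LatticeModels Literature.Probability.Percolation

variable {n : ℕ}

/-- **Deficient-order theorem (glued block, pre-FKG form).**  `o ∉ A ∪ X`, `X ∩ A = ∅`, `b, a ∈ A`;
`o`'s pairs to `X` have weight `1` and `o` has no other positive pair; units are attached only to
`A ∪ {o}`; `rk` injective on `A`.  If every `c ∈ A ∖ {a, b}` satisfies (S1) `a ≤ c` in
`pinW w (K ∪ X×A) ∅` or (S2) `a ≤ c` in `pinW (pinW w T_c ∅) K ∅`, then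
`μ(o ↔ A, o ↮ b) ≤ μ(o ↔ A, a ↮ b)`.
[cite: KozmaNitzan2024, §3.2 Lemma 5 and Theorems 4–5 (p. 13), Question 9 (p. 36)] -/
theorem orderedAnchor_deficient (w : Sym2 (Fin n) → unitInterval) (X A : Finset (Fin n)) (o a b : Fin n)
    (rk : Fin n → ℕ) (hrk : Set.InjOn rk ↑A)
    (hoX : o ∉ X) (hoA : o ∉ A) (hXA : Disjoint X A) (hb : b ∈ A) (ha : a ∈ A)
    (hstar : ∀ x ∈ X, w s(o, x) = 1)
    (hstar0 : ∀ y : Fin n, y ≠ o → y ∉ X → w s(o, y) = 0)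
    (hunit : ∀ x ∈ X, ∀ z : Fin n, z ≠ o → z ∉ A → w s(x, z) = 0)
    (hcert : ∀ c ∈ A, c ≠ a → c ≠ b →
      ((prodBernoulli (pinW w ((↑(X.image fun y => s(o, y)) : Set (Sym2 (Fin n))) ∪
          ↑((X ×ˢ A).image fun p => s(p.1, p.2))) ∅)).real (openConn a b) ≤
        (prodBernoulli (pinW w ((↑(X.image fun y => s(o, y)) : Set (Sym2 (Fin n))) ∪
          ↑((X ×ˢ A).image fun p => s(p.1, p.2))) ∅)).real (openConn c b)) ∨
      ((prodBernoulli (pinW (pinW w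
          (↑((X ×ˢ A.filter fun d => rk d < rk c).image fun p => s(p.1, p.2)) : Set (Sym2 (Fin n))) ∅)
          (↑(X.image fun y => s(o, y)) : Set (Sym2 (Fin n))) ∅)).real (openConn a b) ≤
        (prodBernoulli (pinW (pinW w
          (↑((X ×ˢ A.filter fun d => rk d < rk c).image fun p => s(p.1, p.2)) : Set (Sym2 (Fin n))) ∅)
          (↑(X.image fun y => s(o, y)) : Set (Sym2 (Fin n))) ∅)).real (openConn c b))) :
    (prodBernoulli w).real ((⋃ c ∈ A, openConn o c) ∩ (openConn o b)ᶜ) ≤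
      (prodBernoulli w).real ((⋃ c ∈ A, openConn o c) ∩ (openConn a b)ᶜ) := by
  refine orderedAnchor_of_pieces w X A o a b rk hrk hoX hoA hXA hb ha hstar hstar0 hunit ?_
  intro c hc hca hcb
  set K : Finset (Sym2 (Fin n)) := X.image fun y => s(o, y) with hK
  set T : Finset (Sym2 (Fin n)) := (X ×ˢ A.filter fun d => rk d < rk c).image fun p => s(p.1, p.2) with hT
  have hmeas : ∀ E : Set (BondConfig (Fin n)), MeasurableSet E := fun _ => MeasurableSet.of_discrete
  have hcX : c ∉ X := fun h => Finset.disjoint_left.1 hXA h hc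
  have hco : c ≠ o := fun h => hoA (h ▸ hc)
  -- the star pairs are not among the deleted attachments
  have hstar_notT : ∀ x ∈ X, s(o, x) ∉ (↑T : Set (Sym2 (Fin n))) := by
    intro x hx h
    obtain ⟨p, hp, hpe⟩ := Finset.mem_image.1 (Finset.mem_coe.1 h)
    obtain ⟨hp1, hp2⟩ := Finset.mem_product.1 hp
    have hp2A : p.2 ∈ A := (Finset.mem_filter.1 hp2).1
    rcases Sym2.eq_iff.1 hpe with ⟨h1, _⟩ | ⟨_, h2⟩
    · exact hoX (h1 ▸ hp1)
    · exact hoA (h2 ▸ hp2A)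
  rcases hcert c hc hca hcb with hS1 | hS2
  · /- (S1): the glued comparisons of every first unit `x` hold by `movingAnchor_certificate` with the
       whole block fired (`B = X`); sum them over the first attached unit as in `orderedAnchor_glued`. -/
    set ν := prodBernoulli (pinW w (↑T : Set (Sym2 (Fin n))) ∅) with hν
    set F : Fin n → Finset (Sym2 (Fin n)) := fun x =>
      insert s(x, c) ((X.filter fun x' => x' < x).image fun x' => s(x', c)) with hF
    -- all coins pinned open is `w` itself
    have hKK : pinW w (↑K : Set (Sym2 (Fin n))) (↑K : Set (Sym2 (Fin n))) = w := by
      funext e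
      by_cases he : e ∈ (↑K : Set (Sym2 (Fin n)))
      · rw [pinW_apply_of_mem_of_mem w he he]
        obtain ⟨y, hy, rfl⟩ := Finset.mem_image.1 (Finset.mem_coe.1 he)
        exact (hstar y hy).symm
      · rw [pinW_apply_of_not_mem w _ he]
    have hEX : ∀ x ∈ X, w s(x, c) ≠ 0 →
        (prodBernoulli (pinW (pinW w (↑T : Set (Sym2 (Fin n))) ∅) (↑(F x) : Set (Sym2 (Fin n)))
            {s(x, c)})).real (openConn a b) ≤
        (prodBernoulli (pinW (pinW w (↑T : Set (Sym2 (Fin n))) ∅) (↑(F x) : Set (Sym2 (Fin n)))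
            {s(x, c)})).real (openConn o b) := by
      intro x hx _
      have h := movingAnchor_certificate w X X A o a b c x rk hrk hoX hoA (Finset.Subset.refl X) hXA
        hstar0 hunit ha hc hb hx hS1
      rw [hKK] at h
      exact h
    have hcover : {ω : BondConfig (Fin n) | ∃ x ∈ X, s(x, c) ∈ ω} =
        ⋃ x ∈ X, localCylinder (↑(F x) : Set (Sym2 (Fin n))) {s(x, c)} := orderedAnchor_units_cover X c
    have hsum : ∀ E : Set (BondConfig (Fin n)), ν.real (E ∩ {ω : BondConfig (Fin n) | ∃ x ∈ X, s(x, c) ∈ ω}) =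
        ∑ x ∈ X, ν.real (localCylinder (↑(F x) : Set (Sym2 (Fin n))) {s(x, c)}) *
          (prodBernoulli (pinW (pinW w (↑T : Set (Sym2 (Fin n))) ∅) (↑(F x) : Set (Sym2 (Fin n)))
            {s(x, c)})).real E := by
      intro E
      have hE : E ∩ {ω : BondConfig (Fin n) | ∃ x ∈ X, s(x, c) ∈ ω} =
          ⋃ x ∈ X, (E ∩ localCylinder (↑(F x) : Set (Sym2 (Fin n))) {s(x, c)}) := by
        rw [hcover]; ext ω; simp only [Set.mem_inter_iff, Set.mem_iUnion]; tauto
      rw [hE, measureReal_biUnion_finset (fun x hx x' hx' hne =>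
        (orderedAnchor_units_disjoint X c (Finset.mem_coe.1 hx) (Finset.mem_coe.1 hx') hne).mono
          Set.inter_subset_right Set.inter_subset_right) (fun x _ => hmeas _)]
      refine Finset.sum_congr rfl fun x _ => ?_
      rw [hν, prodBernoulli_real_inter_localCylinder _ (F x) {s(x, c)} (hmeas E)]
    rw [hsum, hsum]
    refine Finset.sum_le_sum fun x hx => ?_
    by_cases hw0 : w s(x, c) = 0
    · -- a weight-zero attachment: the cylinder is null
      have h0 : ν.real (localCylinder (↑(F x) : Set (Sym2 (Fin n))) {s(x, c)}) = 0 := by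
        have hsub : localCylinder (↑(F x) : Set (Sym2 (Fin n))) {s(x, c)} ⊆
            {ω : BondConfig (Fin n) | s(x, c) ∈ ω} := fun ω hω =>
          (hω _ (Finset.mem_coe.2 (Finset.mem_insert_self _ _))).2 (Set.mem_singleton _)
        refine le_antisymm ((measureReal_mono hsub (measure_ne_top _ _)).trans (le_of_eq ?_))
          measureReal_nonneg
        rw [hν, prodBernoulli_real_setOf_mem]
        by_cases hTm : s(x, c) ∈ (↑T : Set (Sym2 (Fin n)))
        · rw [pinW_apply_of_mem_of_not_mem w hTm (Set.notMem_empty _)]; rfl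
        · rw [pinW_apply_of_not_mem w _ hTm, hw0]; rfl
      rw [h0, zero_mul, zero_mul]
    · exact mul_le_mul_of_nonneg_left (hEX x hx hw0) measureReal_nonneg
  · /- (S2): the piece lemma for the weighting with the earlier attachments deleted. -/
    have hstar' : ∀ x ∈ X, pinW w (↑T : Set (Sym2 (Fin n))) ∅ s(o, x) = 1 := by
      intro x hx
      rw [pinW_apply_of_not_mem w _ (hstar_notT x hx)]
      exact hstar x hx
    exact pieceGluing_obs (pinW w (↑T : Set (Sym2 (Fin n))) ∅) X o a c b hoX hcX hstar' hS2

/-- **Deficient-order theorem, `bad ≤ μ(a ↮ b)` form**: under the hypotheses of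
`orderedAnchor_deficient`, `μ(o ↔ A, o ↮ b) ≤ μ(a ↮ b)` (linear gluing with constant `1` and no `δ`
term for the glued block). [cite: KozmaNitzan2024, §3.2 Theorems 4–5 (p. 13), Question 9 (p. 36)] -/
theorem orderedAnchor_deficient_bad_le (w : Sym2 (Fin n) → unitInterval) (X A : Finset (Fin n))
    (o a b : Fin n) (rk : Fin n → ℕ) (hrk : Set.InjOn rk ↑A)
    (hoX : o ∉ X) (hoA : o ∉ A) (hXA : Disjoint X A) (hb : b ∈ A) (ha : a ∈ A)
    (hstar : ∀ x ∈ X, w s(o, x) = 1)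
    (hstar0 : ∀ y : Fin n, y ≠ o → y ∉ X → w s(o, y) = 0)
    (hunit : ∀ x ∈ X, ∀ z : Fin n, z ≠ o → z ∉ A → w s(x, z) = 0)
    (hcert : ∀ c ∈ A, c ≠ a → c ≠ b →
      ((prodBernoulli (pinW w ((↑(X.image fun y => s(o, y)) : Set (Sym2 (Fin n))) ∪
          ↑((X ×ˢ A).image fun p => s(p.1, p.2))) ∅)).real (openConn a b) ≤
        (prodBernoulli (pinW w ((↑(X.image fun y => s(o, y)) : Set (Sym2 (Fin n))) ∪
          ↑((X ×ˢ A).image fun p => s(p.1, p.2))) ∅)).real (openConn c b)) ∨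
      ((prodBernoulli (pinW (pinW w
          (↑((X ×ˢ A.filter fun d => rk d < rk c).image fun p => s(p.1, p.2)) : Set (Sym2 (Fin n))) ∅)
          (↑(X.image fun y => s(o, y)) : Set (Sym2 (Fin n))) ∅)).real (openConn a b) ≤
        (prodBernoulli (pinW (pinW w
          (↑((X ×ˢ A.filter fun d => rk d < rk c).image fun p => s(p.1, p.2)) : Set (Sym2 (Fin n))) ∅)
          (↑(X.image fun y => s(o, y)) : Set (Sym2 (Fin n))) ∅)).real (openConn c b))) :
    (prodBernoulli w).real ((⋃ c ∈ A, openConn o c) ∩ (openConn o b)ᶜ) ≤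
      (prodBernoulli w).real (openConn a b)ᶜ :=
  (orderedAnchor_deficient w X A o a b rk hrk hoX hoA hXA hb ha hstar hstar0 hunit hcert).trans
    (measureReal_mono Set.inter_subset_right (measure_ne_top _ _))

end

end Summit.CriticalPhenomena.PercolationContinuityZ3.Theorems

namespace Summit.CriticalPhenomena.PercolationContinuityZ3.Theorems

open MeasureTheory Set
open Literature.Probability.LatticeModels (prodBernoulli)
open Literature.Probability.Percolation (BondConfig openConn openGraph openGraph_adj)
open scoped BigOperators

noncomputable section
open Classical
open Literature.Probability.LatticeModels Literature.Probability.Percolation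

variable {n : ℕ}

/-- **Deficient-order theorem for ONE-LAYER OBSERVERS (arbitrary coins, pre-FKG form).**  `o ∉ A ∋ b`,
`a ∈ A`, every positive neighbour of `o` a private unit; `X` = units, `K` = coins.  If for every fired set
`B ⊆ X` some injective rank `rk` on `A` certifies every relay `c ∉ {a, b}` by (S1) `a ≤ c` in
`ν_B = pinW w (K ∪ B×A) ∅` (all attachments of `B` deleted) or (S2) `a ≤ c` in `pinW w (K ∪ T_{B,c}) ∅`,
`T_{B,c} = {s(x,c') : x ∈ B, rk c' < rk c}` (only the attachments of `B` into earlier relays deleted), then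
`μ(o ↔ A, o ↮ b) ≤ μ(o ↔ A, a ↮ b)` (rows = coin cylinders; each row is `orderedAnchor_deficient`).
[cite: KozmaNitzan2024, §3.2 Lemma 5, Theorems 4–5 (p. 13), Question 9 (p. 36)] -/
theorem oneLayer_deficientOrder (w : Sym2 (Fin n) → unitInterval) (A : Finset (Fin n)) (o a b : Fin n)
    (hoA : o ∉ A) (hb : b ∈ A) (ha : a ∈ A)
    (hX : ∀ y : Fin n, y ≠ o → w s(o, y) ≠ 0 → y ∉ A ∧ ∀ z : Fin n, z ≠ o → z ∉ A → w s(y, z) = 0)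
    (hcert : ∀ B : Finset (Fin n), B ⊆ (Finset.univ.filter fun y : Fin n => y ≠ o ∧ w s(o, y) ≠ 0) →
      ∃ rk : Fin n → ℕ, Set.InjOn rk ↑A ∧ ∀ c ∈ A, c ≠ a → c ≠ b →
        ((prodBernoulli (pinW w
            ((↑((Finset.univ.filter fun y : Fin n => y ≠ o ∧ w s(o, y) ≠ 0).image fun x => s(o, x)) :
              Set (Sym2 (Fin n))) ∪ ↑((B ×ˢ A).image fun p => s(p.1, p.2))) ∅)).real (openConn a b) ≤
          (prodBernoulli (pinW w
            ((↑((Finset.univ.filter fun y : Fin n => y ≠ o ∧ w s(o, y) ≠ 0).image fun x => s(o, x)) :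
              Set (Sym2 (Fin n))) ∪ ↑((B ×ˢ A).image fun p => s(p.1, p.2))) ∅)).real (openConn c b)) ∨
        ((prodBernoulli (pinW w
            ((↑((Finset.univ.filter fun y : Fin n => y ≠ o ∧ w s(o, y) ≠ 0).image fun x => s(o, x)) :
              Set (Sym2 (Fin n))) ∪
              ↑((B ×ˢ A.filter fun d => rk d < rk c).image fun p => s(p.1, p.2))) ∅)).real (openConn a b) ≤
          (prodBernoulli (pinW w
            ((↑((Finset.univ.filter fun y : Fin n => y ≠ o ∧ w s(o, y) ≠ 0).image fun x => s(o, x)) :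
              Set (Sym2 (Fin n))) ∪
              ↑((B ×ˢ A.filter fun d => rk d < rk c).image fun p => s(p.1, p.2))) ∅)).real (openConn c b))) :
    (prodBernoulli w).real ((⋃ c ∈ A, openConn o c) ∩ (openConn o b)ᶜ) ≤
      (prodBernoulli w).real ((⋃ c ∈ A, openConn o c) ∩ (openConn a b)ᶜ) := by
  set X : Finset (Fin n) := Finset.univ.filter fun y : Fin n => y ≠ o ∧ w s(o, y) ≠ 0 with hXdef
  set K : Finset (Sym2 (Fin n)) := X.image fun x => s(o, x) with hKdef
  have hmeas : ∀ E : Set (BondConfig (Fin n)), MeasurableSet E := fun _ => MeasurableSet.of_discrete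
  obtain ⟨Bu, hBu⟩ : ∃ Bu : Set (BondConfig (Fin n)), Bu = Set.univ := ⟨Set.univ, rfl⟩
  have hdet : DeterminedBy Bu (↑K : Set (Sym2 (Fin n))) :=
    (determinedBy_iff _ _).2 fun _ _ _ => by simp [hBu]
  have hint : ∀ E : Set (BondConfig (Fin n)), E ∩ Bu = E := fun E => by rw [hBu, Set.inter_univ]
  have hrows : ∀ E : Set (BondConfig (Fin n)), (prodBernoulli w).real E =
      ∑ P ∈ K.powerset.filter (fun P : Finset (Sym2 (Fin n)) => (↑P : Set (Sym2 (Fin n))) ∈ Bu),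
        (prodBernoulli w).real (localCylinder ↑K ↑P) * (prodBernoulli (pinW w ↑K ↑P)).real E := by
    intro E
    have h := prodBernoulli_real_inter_eq_sum_pinW w K (hmeas E) hdet
    rwa [hint] at h
  rw [hrows, hrows ((⋃ c ∈ A, openConn o c) ∩ (openConn a b)ᶜ)]
  refine Finset.sum_le_sum fun P hP => ?_
  have hPK : P ⊆ K := Finset.mem_powerset.1 (Finset.mem_filter.1 hP).1
  refine mul_le_mul_of_nonneg_left ?_ measureReal_nonneg
  -- the row `P`: a glued block on `B = {x ∈ X : s(o,x) ∈ P}`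
  set B : Finset (Fin n) := X.filter fun x => s(o, x) ∈ P with hBdef
  set wP := pinW w (↑K : Set (Sym2 (Fin n))) ↑P with hwP
  have hBX : B ⊆ X := Finset.filter_subset _ _
  have hXunit : ∀ x ∈ X, x ≠ o ∧ w s(o, x) ≠ 0 := fun x hx => (Finset.mem_filter.1 hx).2
  have hoX : o ∉ X := fun h => (hXunit o h).1 rfl
  have hoB : o ∉ B := fun h => hoX (hBX h)
  have hXA : Disjoint X A := by
    rw [Finset.disjoint_left]
    intro x hx
    exact (hX x (hXunit x hx).1 (hXunit x hx).2).1
  have hBA : Disjoint B A := hXA.mono_left hBX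
  have hstar : ∀ x ∈ B, wP s(o, x) = 1 := by
    intro x hx
    obtain ⟨hxX, hxP⟩ := Finset.mem_filter.1 hx
    have hKm : s(o, x) ∈ (↑K : Set (Sym2 (Fin n))) := Finset.mem_coe.2 (Finset.mem_image.2 ⟨x, hxX, rfl⟩)
    rw [hwP, pinW_apply_of_mem_of_mem w hKm (Finset.mem_coe.2 hxP)]
  have hstar0 : ∀ y : Fin n, y ≠ o → y ∉ B → wP s(o, y) = 0 := by
    intro y hyo hyB
    by_cases hyX : y ∈ X
    · have hKm : s(o, y) ∈ (↑K : Set (Sym2 (Fin n))) := Finset.mem_coe.2 (Finset.mem_image.2 ⟨y, hyX, rfl⟩)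
      have hP' : s(o, y) ∉ (↑P : Set (Sym2 (Fin n))) := fun h =>
        hyB (Finset.mem_filter.2 ⟨hyX, Finset.mem_coe.1 h⟩)
      rw [hwP, pinW_apply_of_mem_of_not_mem w hKm hP']
    · have hw0 : w s(o, y) = 0 := by
        by_contra h
        exact hyX (Finset.mem_filter.2 ⟨Finset.mem_univ _, hyo, h⟩)
      have hKm : s(o, y) ∉ (↑K : Set (Sym2 (Fin n))) := by
        intro h
        obtain ⟨x, hx, hxe⟩ := Finset.mem_image.1 (Finset.mem_coe.1 h)
        have hxo : x ≠ o := (hXunit x hx).1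
        rcases Sym2.eq_iff.1 hxe with ⟨_, h2⟩ | ⟨_, h2⟩
        · exact hyX (h2 ▸ hx)
        · exact hxo h2
      rw [hwP, pinW_apply_of_not_mem w _ hKm, hw0]
  have hunit : ∀ x ∈ B, ∀ z : Fin n, z ≠ o → z ∉ A → wP s(x, z) = 0 := by
    intro x hx z hzo hzA
    have hxX := hBX hx
    have hxo : x ≠ o := (hXunit x hxX).1
    have hKm : s(x, z) ∉ (↑K : Set (Sym2 (Fin n))) := by
      intro h
      obtain ⟨x', hx', hxe⟩ := Finset.mem_image.1 (Finset.mem_coe.1 h)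
      rcases Sym2.eq_iff.1 hxe with ⟨h1, _⟩ | ⟨h1, _⟩
      · exact hxo h1.symm
      · exact hzo h1.symm
    rw [hwP, pinW_apply_of_not_mem w _ hKm]
    exact (hX x hxo (hXunit x hxX).2).2 z hzo hzA
  obtain ⟨rk, hrk, hcertB⟩ := hcert B hBX
  -- the coin image of `B` is the pattern `P`
  have hPeq : (B.image fun x => s(o, x)) = P := by
    ext e
    constructor
    · intro he
      obtain ⟨x, hx, rfl⟩ := Finset.mem_image.1 he
      exact (Finset.mem_filter.1 hx).2
    · intro he
      obtain ⟨x, hx, rfl⟩ := Finset.mem_image.1 (hPK he)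
      exact Finset.mem_image.2 ⟨x, Finset.mem_filter.2 ⟨hx, he⟩, rfl⟩
  -- membership facts: coins versus attachments
  have hK_of_B : ∀ {S : Finset (Fin n)}, (∀ y ∈ S, y ∈ A) → ∀ e ∈ (B ×ˢ S).image
      (fun p : Fin n × Fin n => s(p.1, p.2)), e ∉ (↑K : Set (Sym2 (Fin n))) := by
    intro S hSA e he hKe
    obtain ⟨p, hp, rfl⟩ := Finset.mem_image.1 he
    obtain ⟨hp1, hp2⟩ := Finset.mem_product.1 hp
    obtain ⟨x', hx', hxe⟩ := Finset.mem_image.1 (Finset.mem_coe.1 hKe)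
    have hp1o : p.1 ≠ o := (hXunit p.1 (hBX hp1)).1
    have hp2o : p.2 ≠ o := fun h => hoA (h ▸ hSA p.2 hp2)
    rcases Sym2.eq_iff.1 hxe with ⟨h1, _⟩ | ⟨h1, _⟩
    · exact hp1o h1.symm
    · exact hp2o h1.symm
  -- (E) the two weightings of `orderedAnchor_deficient` for `wP`, rewritten in terms of `w`
  have hE : ∀ (S : Finset (Fin n)), (∀ y ∈ S, y ∈ A) →
      pinW wP ((↑(B.image fun y => s(o, y)) : Set (Sym2 (Fin n))) ∪
          ↑((B ×ˢ S).image fun p : Fin n × Fin n => s(p.1, p.2))) ∅ =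
        pinW w ((↑K : Set (Sym2 (Fin n))) ∪ ↑((B ×ˢ S).image fun p : Fin n × Fin n => s(p.1, p.2))) ∅ ∧
      pinW (pinW wP (↑((B ×ˢ S).image fun p : Fin n × Fin n => s(p.1, p.2)) : Set (Sym2 (Fin n))) ∅)
          (↑(B.image fun y => s(o, y)) : Set (Sym2 (Fin n))) ∅ =
        pinW w ((↑K : Set (Sym2 (Fin n))) ∪ ↑((B ×ˢ S).image fun p : Fin n × Fin n => s(p.1, p.2))) ∅ := by
    intro S hSA
    set TS : Finset (Sym2 (Fin n)) := (B ×ˢ S).image fun p : Fin n × Fin n => s(p.1, p.2) with hTS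
    rw [hPeq]
    have key : ∀ e : Sym2 (Fin n),
        (pinW wP ((↑P : Set (Sym2 (Fin n))) ∪ ↑TS) ∅ e =
          pinW w ((↑K : Set (Sym2 (Fin n))) ∪ ↑TS) ∅ e) ∧
        (pinW (pinW wP (↑TS : Set (Sym2 (Fin n))) ∅) (↑P : Set (Sym2 (Fin n))) ∅ e =
          pinW w ((↑K : Set (Sym2 (Fin n))) ∪ ↑TS) ∅ e) := by
      intro e
      by_cases heT : e ∈ (↑TS : Set (Sym2 (Fin n)))
      · have heKT : e ∈ (↑K : Set (Sym2 (Fin n))) ∪ ↑TS := Or.inr heT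
        have hePT : e ∈ (↑P : Set (Sym2 (Fin n))) ∪ ↑TS := Or.inr heT
        have heP : e ∉ (↑P : Set (Sym2 (Fin n))) := fun h =>
          hK_of_B hSA e (Finset.mem_coe.1 heT) (Finset.mem_coe.2 (hPK (Finset.mem_coe.1 h)))
        refine ⟨?_, ?_⟩
        · rw [pinW_apply_of_mem_of_not_mem wP hePT (Set.notMem_empty _),
            pinW_apply_of_mem_of_not_mem w heKT (Set.notMem_empty _)]
        · rw [pinW_apply_of_not_mem _ _ heP, pinW_apply_of_mem_of_not_mem wP heT (Set.notMem_empty _),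
            pinW_apply_of_mem_of_not_mem w heKT (Set.notMem_empty _)]
      · by_cases heK : e ∈ (↑K : Set (Sym2 (Fin n)))
        · have heKT : e ∈ (↑K : Set (Sym2 (Fin n))) ∪ ↑TS := Or.inl heK
          by_cases heP : e ∈ (↑P : Set (Sym2 (Fin n)))
          · have hePT : e ∈ (↑P : Set (Sym2 (Fin n))) ∪ ↑TS := Or.inl heP
            refine ⟨?_, ?_⟩
            · rw [pinW_apply_of_mem_of_not_mem wP hePT (Set.notMem_empty _),
                pinW_apply_of_mem_of_not_mem w heKT (Set.notMem_empty _)]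
            · rw [pinW_apply_of_mem_of_not_mem _ heP (Set.notMem_empty _),
                pinW_apply_of_mem_of_not_mem w heKT (Set.notMem_empty _)]
          · have hePT : e ∉ (↑P : Set (Sym2 (Fin n))) ∪ ↑TS := fun h => h.elim heP heT
            have hwP0 : wP e = 0 := by rw [hwP, pinW_apply_of_mem_of_not_mem w heK heP]
            refine ⟨?_, ?_⟩
            · rw [pinW_apply_of_not_mem wP _ hePT, hwP0,
                pinW_apply_of_mem_of_not_mem w heKT (Set.notMem_empty _)]
            · rw [pinW_apply_of_not_mem _ _ heP, pinW_apply_of_not_mem wP _ heT, hwP0,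
                pinW_apply_of_mem_of_not_mem w heKT (Set.notMem_empty _)]
        · have heKT : e ∉ (↑K : Set (Sym2 (Fin n))) ∪ ↑TS := fun h => h.elim heK heT
          have heP : e ∉ (↑P : Set (Sym2 (Fin n))) := fun h => heK (Finset.mem_coe.2 (hPK (Finset.mem_coe.1 h)))
          have hePT : e ∉ (↑P : Set (Sym2 (Fin n))) ∪ ↑TS := fun h => h.elim heP heT
          have hwPe : wP e = w e := by rw [hwP, pinW_apply_of_not_mem w _ heK]
          refine ⟨?_, ?_⟩
          · rw [pinW_apply_of_not_mem wP _ hePT, hwPe, pinW_apply_of_not_mem w _ heKT]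
          · rw [pinW_apply_of_not_mem _ _ heP, pinW_apply_of_not_mem wP _ heT, hwPe,
              pinW_apply_of_not_mem w _ heKT]
    exact ⟨funext fun e => (key e).1, funext fun e => (key e).2⟩
  refine orderedAnchor_deficient wP B A o a b rk hrk hoB hoA hBA hb ha hstar hstar0 hunit ?_
  intro c hc hca hcb
  rcases hcertB c hc hca hcb with h1 | h2
  · exact Or.inl (by rw [(hE A fun y hy => hy).1]; exact h1)
  · exact Or.inr (by rw [(hE (A.filter fun d => rk d < rk c) fun y hy => (Finset.mem_filter.1 hy).1).2]; exact h2)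

/-- **Deficient-order theorem for one-layer observers, `bad ≤ μ(a ↮ b)` form**: under the hypotheses of
`oneLayer_deficientOrder`, `μ(o ↔ A, o ↮ b) ≤ μ(a ↮ b)` — linear gluing with constant `1` and no
`μ(o ↮ A)` term. [cite: KozmaNitzan2024, §3.2 Theorem 5 (p. 13), Question 9 (p. 36)] -/
theorem oneLayer_deficientOrder_bad_le (w : Sym2 (Fin n) → unitInterval) (A : Finset (Fin n)) (o a b : Fin n)
    (hoA : o ∉ A) (hb : b ∈ A) (ha : a ∈ A)
    (hX : ∀ y : Fin n, y ≠ o → w s(o, y) ≠ 0 → y ∉ A ∧ ∀ z : Fin n, z ≠ o → z ∉ A → w s(y, z) = 0)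
    (hcert : ∀ B : Finset (Fin n), B ⊆ (Finset.univ.filter fun y : Fin n => y ≠ o ∧ w s(o, y) ≠ 0) →
      ∃ rk : Fin n → ℕ, Set.InjOn rk ↑A ∧ ∀ c ∈ A, c ≠ a → c ≠ b →
        ((prodBernoulli (pinW w
            ((↑((Finset.univ.filter fun y : Fin n => y ≠ o ∧ w s(o, y) ≠ 0).image fun x => s(o, x)) :
              Set (Sym2 (Fin n))) ∪ ↑((B ×ˢ A).image fun p => s(p.1, p.2))) ∅)).real (openConn a b) ≤
          (prodBernoulli (pinW w
            ((↑((Finset.univ.filter fun y : Fin n => y ≠ o ∧ w s(o, y) ≠ 0).image fun x => s(o, x)) :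
              Set (Sym2 (Fin n))) ∪ ↑((B ×ˢ A).image fun p => s(p.1, p.2))) ∅)).real (openConn c b)) ∨
        ((prodBernoulli (pinW w
            ((↑((Finset.univ.filter fun y : Fin n => y ≠ o ∧ w s(o, y) ≠ 0).image fun x => s(o, x)) :
              Set (Sym2 (Fin n))) ∪
              ↑((B ×ˢ A.filter fun d => rk d < rk c).image fun p => s(p.1, p.2))) ∅)).real (openConn a b) ≤
          (prodBernoulli (pinW w
            ((↑((Finset.univ.filter fun y : Fin n => y ≠ o ∧ w s(o, y) ≠ 0).image fun x => s(o, x)) :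
              Set (Sym2 (Fin n))) ∪
              ↑((B ×ˢ A.filter fun d => rk d < rk c).image fun p => s(p.1, p.2))) ∅)).real (openConn c b))) :
    (prodBernoulli w).real ((⋃ c ∈ A, openConn o c) ∩ (openConn o b)ᶜ) ≤
      (prodBernoulli w).real (openConn a b)ᶜ :=
  (oneLayer_deficientOrder w A o a b hoA hb ha hX hcert).trans
    (measureReal_mono Set.inter_subset_right (measure_ne_top _ _))

end

end Summit.CriticalPhenomena.PercolationContinuityZ3.Theorems
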